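import Literature.Analysis.FluidPDE.ParabolicHeatPotentials
import HarnessLib

/-!
# Hölder continuity of parabolic singular potentials of Morrey data

Analysis/FluidPDE file in the decomposition of the named fact
`Literature.Analysis.FluidPDE.LemarieRieusset2016.prop13_4` (`ParabolicHeatPotentials.lean`:
Lemarié-Rieusset 2016, Prop. 13.4 p. 464 — heat potentials `∫₀ᵗ W_{ν(t-s)} * (f + σ(D)g) ds` of
parabolic-Morrey data are Hölder continuous for the parabolic distance), towards
`LemarieRieusset2016.lemma13_6` (Lemma 13.6, `CKNMorreyLemmas.lean`).

The printed proof of Prop. 13.4 (p. 465) uses of the kernels `W₊`, `σ(D)W₊` only size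
estimates (`|W₊| ≤ Cρ₂⁻³`, `|∇W₊| ≤ Cρ₂⁻⁴`, `|∂ₜW₊| ≤ Cρ₂⁻⁵`, resp. `|σ(D)W₊| ≤ Cρ₂⁻⁴`,
`|∇σ(D)W₊| ≤ Cρ₂⁻⁵`, `|∂ₜσ(D)W₊| ≤ Cρ₂⁻⁶`, `ρ₂` the parabolic norm), and of the data only the
Morrey bound `∫∫_{Q_r} |f| ≤ ‖f‖ r^{5(1 - 1/q)}`; the Hölder estimate is then a dyadic
decomposition around the two points. This file **proves** that real-variable statement in
abstract form, for an arbitrary kernel `K` on `ℝ × ℝ³` with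

* the size bound `|K(z)| ρ₂(z)^m ≤ A`, and
* the regularity bound `|K(z) - K(z - z')| ρ₂(z)^{m+1} ≤ A ρ₂(z')` whenever `ρ₂(z) ≥ 2ρ₂(z')`,

and data `F` with `∫∫_{Q_r(c)} |F| ≤ B r^d` for all cylinders, in the range `m < d < m + 1`:
the potential `h(z) = ∫ K(z - w) F(w) dw` (assumed absolutely convergent at every point) satisfies
`|h(z₁) - h(z₂)| ≤ C(m, d) A B ρ₂(z₁ - z₂)^{d - m}` (`parabolicHolderOnWith_integral_of_kernel_bounds`,
with the explicit constant `kernelHolderConst A B m d`).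

Scope. The regularity bound holds for kernels that are smooth on `ℝ × ℝ³ ∖ {0}` with the
parabolic gradient bounds, by the mean value inequality: this is the case of `W₊` itself
(`m = 3`; with `f ∈ ℳ₂^{p,q₀}`, `5/2 < q₀ < 5`, `d = 5(1 - 1/q₀) ∈ (3, 4)` and the exponent is
`d - m = 2 - 5/q₀ = α`, the `f`-part of Prop. 13.4) and of `∂ᵢW₊` (`m = 4`), which vanish to
infinite order at `t = 0` away from the origin. It is NOT the case of `σ(D)W₊` for a general
symbol homogeneous of degree `1` (e.g. `ξₖξⱼξₗ/|ξ|²`): `σ(D)W_{νt} → σ(D)δ` as `t ↓ 0`, a nonzero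
function `c_σ(y) ∼ |y|⁻⁴` off the origin, so `1_{t>0} σ(D)W_{νt}` jumps across `t = 0` and the
printed bound `|∂ₜσ(D)W₊| ≤ Cρ₂⁻⁶` only holds for `t > 0`; the `g`-part of Prop. 13.4 needs in
addition an estimate of the contribution of the thin slab `t - ρ₂(z₁-z₂)² < s < t` (mass of Morrey
data in thin slabs), which is not covered here.

Contents:

* `parabolicNorm z = √|t| + ‖x‖` (so that `parabolicDist z₁ z₂ = parabolicNorm (z₁ - z₂)`),
  a genuine norm-like function: triangle inequality `parabolicNorm_add_le`, symmetry,
  `parabolicNorm_eq_zero_iff`, continuity; the parabolic balls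
  `parabolicBall c R = {w | ρ₂(c - w) < R} ⊆ Q_R(c)`;
* the two dyadic estimates: `∫_{ρ₂(c-w) < R} ρ₂(c-w)^{-m} |F(w)| dw ≤ C B R^{d-m}` (`m < d`,
  `lintegral_parabolicBall_rpow_neg_mul_le`) and
  `∫_{ρ₂(c-w) ≥ R} ρ₂(c-w)^{-(m+1)} |F(w)| dw ≤ C B R^{d-m-1}` (`d < m + 1`,
  `lintegral_compl_parabolicBall_rpow_neg_mul_le`);
* the Hölder estimate `parabolicHolderOnWith_integral_of_kernel_bounds`;
* the bridge from the accepted Morrey condition `IsParabolicMorreyOn univ (‖F ·‖ₑ) p q`, `p ≥ 1`,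
  to the `L¹`-Morrey bound used here (`exists_morrey_one_bound`), and the rewriting of the
  accepted `heatPotential` as such an integral (`heatPotential_eq_integral_mul`).

Nothing here is specific to the heat kernel; the kernel bounds for `W₊`, the absolute
convergence of the heat potentials, and the `σ(D)`-part (see Scope) are the remaining inputs of
`prop13_4`.

## References

* P. G. Lemarié-Rieusset, *The Navier–Stokes Problem in the 21st Century*, CRC Press (2016),
  Prop. 13.4 and its proof, pp. 464–465. [LemarieRieusset2016]
* O. A. Ladyzhenskaya, V. A. Solonnikov, N. N. Ural'tseva, *Linear and quasi-linear equations of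
  parabolic type*, AMS (1968), Ch. IV §1–2 (heat-kernel size estimates; potentials of Hölder and
  integrable densities).
-/

noncomputable section

open MeasureTheory Set Function Filter Metric
open scoped NNReal ENNReal

namespace Literature.Analysis.FluidPDE

/-- Local notation for physical space `ℝ³ = EuclideanSpace ℝ (Fin 3)`. -/
local notation "ℝ³" => EuclideanSpace ℝ (Fin 3)

/-! ### The parabolic norm -/

section ParabolicNorm

variable {X : Type*} [NormedAddCommGroup X]

/-- The **parabolic norm** `ρ₂(t, x) = √|t| + ‖x‖` on `ℝ × X` (Lemarié-Rieusset 2016, p. 462),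
so that the accepted parabolic distance on `ℝ × ℝ³` is `parabolicDist z₁ z₂ = parabolicNorm (z₁ - z₂)`. [cite: LemarieRieusset2016, §13.8 p. 462] -/
def parabolicNorm (z : ℝ × X) : ℝ :=
  Real.sqrt |z.1| + ‖z.2‖

/-- The parabolic norm is nonnegative. [folklore] -/
theorem parabolicNorm_nonneg (z : ℝ × X) : 0 ≤ parabolicNorm z :=
  add_nonneg (Real.sqrt_nonneg _) (norm_nonneg _)

/-- The parabolic norm of `0` vanishes. [folklore] -/
@[simp]
theorem parabolicNorm_zero : parabolicNorm (0 : ℝ × X) = 0 := by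
  simp [parabolicNorm]

/-- The parabolic norm is even. [folklore] -/
@[simp]
theorem parabolicNorm_neg (z : ℝ × X) : parabolicNorm (-z) = parabolicNorm z := by
  simp [parabolicNorm]

/-- `ρ₂(z₁ - z₂) = ρ₂(z₂ - z₁)`. [folklore] -/
theorem parabolicNorm_sub_comm (z₁ z₂ : ℝ × X) :
    parabolicNorm (z₁ - z₂) = parabolicNorm (z₂ - z₁) := by
  rw [← parabolicNorm_neg, neg_sub]

/-- The parabolic norm vanishes only at the origin. [folklore] -/
theorem parabolicNorm_eq_zero_iff (z : ℝ × X) : parabolicNorm z = 0 ↔ z = 0 := by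
  constructor
  · intro h
    have h1 : 0 ≤ Real.sqrt |z.1| := Real.sqrt_nonneg _
    have h2 : 0 ≤ ‖z.2‖ := norm_nonneg _
    have ha : Real.sqrt |z.1| = 0 := by unfold parabolicNorm at h; linarith
    have hb : ‖z.2‖ = 0 := by unfold parabolicNorm at h; linarith
    rw [Real.sqrt_eq_zero (abs_nonneg _)] at ha
    exact Prod.ext (abs_eq_zero.1 ha) (norm_eq_zero.1 hb)
  · rintro rfl
    exact parabolicNorm_zero

/-- The parabolic norm is positive away from the origin. [folklore] -/
theorem parabolicNorm_pos {z : ℝ × X} (hz : z ≠ 0) : 0 < parabolicNorm z :=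
  lt_of_le_of_ne (parabolicNorm_nonneg z) fun h => hz ((parabolicNorm_eq_zero_iff z).1 h.symm)

/-- `√(a + b) ≤ √a + √b` for `a, b ≥ 0` (local copy of a lemma several tree files state). [folklore] -/
private theorem sqrt_add_le_sqrt_add_sqrt {a b : ℝ} (ha : 0 ≤ a) (hb : 0 ≤ b) :
    Real.sqrt (a + b) ≤ Real.sqrt a + Real.sqrt b := by
  rw [Real.sqrt_le_iff]
  refine ⟨by positivity, ?_⟩
  nlinarith [Real.sq_sqrt ha, Real.sq_sqrt hb, Real.sqrt_nonneg a, Real.sqrt_nonneg b,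
    mul_nonneg (Real.sqrt_nonneg a) (Real.sqrt_nonneg b)]

/-- **Triangle inequality for the parabolic norm**: `ρ₂(z + z') ≤ ρ₂(z) + ρ₂(z')`
(`|s + t|^{1/2} ≤ |s|^{1/2} + |t|^{1/2}`). [folklore] -/
theorem parabolicNorm_add_le (z z' : ℝ × X) :
    parabolicNorm (z + z') ≤ parabolicNorm z + parabolicNorm z' := by
  have h1 : Real.sqrt |(z + z').1| ≤ Real.sqrt |z.1| + Real.sqrt |z'.1| := by
    simp only [Prod.fst_add]
    exact (Real.sqrt_le_sqrt (abs_add_le z.1 z'.1)).trans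
      (sqrt_add_le_sqrt_add_sqrt (abs_nonneg _) (abs_nonneg _))
  have h2 : ‖(z + z').2‖ ≤ ‖z.2‖ + ‖z'.2‖ := by
    simp only [Prod.snd_add]
    exact norm_add_le _ _
  unfold parabolicNorm
  linarith

/-- `ρ₂(a - c) ≤ ρ₂(a - b) + ρ₂(b - c)`. [folklore] -/
theorem parabolicNorm_sub_le (a b c : ℝ × X) :
    parabolicNorm (a - c) ≤ parabolicNorm (a - b) + parabolicNorm (b - c) := by
  have : a - c = (a - b) + (b - c) := by abel
  rw [this]
  exact parabolicNorm_add_le _ _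

/-- The parabolic norm is continuous. [folklore] -/
theorem continuous_parabolicNorm : Continuous (parabolicNorm : ℝ × X → ℝ) := by
  unfold parabolicNorm
  fun_prop

/-- The **parabolic ball** `{w | ρ₂(c - w) < R}` of radius `R` about `c` (Lemarié-Rieusset 2016,
p. 462: the balls `B((t, x), r)` of the parabolic distance, `B((t,x), r) ⊂ Q_r(t, x)`). [cite: LemarieRieusset2016, §13.8 p. 462] -/
def parabolicBall (c : ℝ × X) (R : ℝ) : Set (ℝ × X) :=
  {w | parabolicNorm (c - w) < R}

/-- Membership in a parabolic ball. [folklore] -/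
@[simp]
theorem mem_parabolicBall {c w : ℝ × X} {R : ℝ} :
    w ∈ parabolicBall c R ↔ parabolicNorm (c - w) < R :=
  Iff.rfl

/-- Parabolic balls are open. [folklore] -/
theorem isOpen_parabolicBall (c : ℝ × X) (R : ℝ) : IsOpen (parabolicBall c R) :=
  isOpen_lt (continuous_parabolicNorm.comp (continuous_const.sub continuous_id)) continuous_const

/-- Parabolic balls are measurable. [folklore] -/
theorem measurableSet_parabolicBall [MeasurableSpace X] [OpensMeasurableSpace X]
    [SecondCountableTopology X] (c : ℝ × X) (R : ℝ) :
    MeasurableSet (parabolicBall c R) :=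
  (isOpen_parabolicBall c R).measurableSet

/-- **`B((t,x), r) ⊂ Q_r(t, x)`** (Lemarié-Rieusset 2016, p. 462): the parabolic ball lies in the
centred parabolic cylinder of the same radius (`|t - s|^{1/2} < r ⟹ |t - s| < r²`). [cite: LemarieRieusset2016, §13.8 p. 462] -/
theorem parabolicBall_subset_cylinder (c : ℝ × X) (R : ℝ) :
    parabolicBall c R ⊆ FluidPDE.parabolicCylinderCentered R c := by
  intro w hw
  rw [mem_parabolicBall, parabolicNorm] at hw
  have h1 : 0 ≤ Real.sqrt |(c - w).1| := Real.sqrt_nonneg _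
  have h2 : 0 ≤ ‖(c - w).2‖ := norm_nonneg _
  have ht : Real.sqrt |(c - w).1| < R := by linarith
  have hx : ‖(c - w).2‖ < R := by linarith
  have hR : 0 < R := lt_of_le_of_lt h1 ht
  have ht' : |c.1 - w.1| < R ^ 2 := by
    rw [Real.sqrt_lt' hR, Prod.fst_sub] at ht
    exact ht
  rw [FluidPDE.mem_parabolicCylinderCentered, dist_eq_norm]
  rw [abs_lt] at ht'
  refine ⟨⟨by linarith, by linarith⟩, ?_⟩
  rw [Prod.snd_sub] at hx
  rwa [← norm_neg, neg_sub] at hx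

end ParabolicNorm

/-- On `ℝ × ℝ³` the accepted parabolic distance is the parabolic norm of the difference. [folklore] -/
theorem parabolicDist_eq_parabolicNorm (z₁ z₂ : ℝ × ℝ³) :
    parabolicDist z₁ z₂ = parabolicNorm (z₁ - z₂) :=
  rfl

/-! ### The two dyadic estimates -/

section Dyadic

variable {E' : Type*} [NormedAddCommGroup E']

/-- The `L¹`-Morrey bound transfers from cylinders to parabolic balls. [folklore] -/
theorem lintegral_parabolicBall_le_of_morrey {F : ℝ × ℝ³ → E'} {B d : ℝ}
    (hMor : ∀ (c : ℝ × ℝ³) (r : ℝ), 0 < r →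
      ∫⁻ w in FluidPDE.parabolicCylinderCentered r c, ‖F w‖ₑ ≤ ENNReal.ofReal (B * r ^ d))
    (c : ℝ × ℝ³) {r : ℝ} (hr : 0 < r) :
    ∫⁻ w in parabolicBall c r, ‖F w‖ₑ ≤ ENNReal.ofReal (B * r ^ d) :=
  (lintegral_mono_set (parabolicBall_subset_cylinder c r)).trans (hMor c r hr)

/-- **The near-field dyadic estimate**: for `0 < m < d` and data with
`∫∫_{Q_r(c)} |F| ≤ B r^d`, `∫_{ρ₂(c-w) < R} ρ₂(c - w)^{-m} |F(w)| dw ≤ 2^d 2^m (1 - 2^{m-d})⁻¹ B R^{d-m}`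
(decompose into the shells `R/2^{n+1} < ρ₂ ≤ R/2^n`, on which `ρ₂^{-m} ≤ (R/2^{n+1})^{-m}`, and sum
the geometric series). [folklore] -/
theorem lintegral_parabolicBall_rpow_neg_mul_le {F : ℝ × ℝ³ → E'} {B d m R : ℝ} (hB : 0 ≤ B)
    (hm : 0 < m) (hmd : m < d) (hF : AEMeasurable (fun w => ‖F w‖ₑ) volume)
    (hMor : ∀ (c : ℝ × ℝ³) (r : ℝ), 0 < r →
      ∫⁻ w in FluidPDE.parabolicCylinderCentered r c, ‖F w‖ₑ ≤ ENNReal.ofReal (B * r ^ d))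
    (c : ℝ × ℝ³) (hR : 0 < R) :
    ∫⁻ w in parabolicBall c R, ENNReal.ofReal (parabolicNorm (c - w) ^ (-m)) * ‖F w‖ₑ ≤
      ENNReal.ofReal (2 ^ d * 2 ^ m * (1 - ((2 : ℝ) ^ (d - m))⁻¹)⁻¹ * B * R ^ (d - m)) := by
  -- the dyadic radii and the geometric ratio
  set r : ℕ → ℝ := fun n => R / 2 ^ n with hr
  have hr0 : ∀ n, 0 < r n := fun n => by positivity
  set θ : ℝ := ((2 : ℝ) ^ (d - m))⁻¹ with hθ
  have h2dm : 1 < (2 : ℝ) ^ (d - m) := Real.one_lt_rpow one_lt_two (by linarith)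
  have hθ0 : 0 ≤ θ := by positivity
  have hθ1 : θ < 1 := inv_lt_one_of_one_lt₀ h2dm
  -- the coefficients `a n = (r n / 2)^{-m}` and the terms of the series
  set a : ℕ → ℝ := fun n => (r n / 2) ^ (-m) with ha
  have ha0 : ∀ n, 0 ≤ a n := fun n => Real.rpow_nonneg (by positivity) _
  have hterm : ∀ n, a n * (B * (2 * r n) ^ d) = 2 ^ d * 2 ^ m * B * R ^ (d - m) * θ ^ n := by
    intro n
    have hrn := hr0 n
    have h1 : a n = 2 ^ m / r n ^ m := by
      rw [ha]
      simp only
      rw [Real.rpow_neg (by positivity), Real.div_rpow hrn.le (by norm_num), inv_div]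
    have h2 : (2 * r n) ^ d = 2 ^ d * r n ^ d := Real.mul_rpow (by norm_num) hrn.le
    have h3 : r n ^ d / r n ^ m = r n ^ (d - m) := by rw [Real.rpow_sub hrn]
    have h4 : r n ^ (d - m) = R ^ (d - m) * θ ^ n := by
      rw [hr, hθ]
      simp only
      rw [Real.div_rpow hR.le (by positivity), ← Real.rpow_natCast (2 : ℝ) n,
        ← Real.rpow_mul (by norm_num : (0 : ℝ) ≤ 2), mul_comm (n : ℝ) (d - m),
        Real.rpow_mul (by norm_num : (0 : ℝ) ≤ 2), Real.rpow_natCast, inv_pow, div_eq_mul_inv]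
    calc a n * (B * (2 * r n) ^ d) = 2 ^ d * 2 ^ m * B * (r n ^ d / r n ^ m) := by
          rw [h1, h2]; field_simp
      _ = 2 ^ d * 2 ^ m * B * R ^ (d - m) * θ ^ n := by rw [h3, h4]; ring
  have hterm0 : ∀ n, 0 ≤ 2 ^ d * 2 ^ m * B * R ^ (d - m) * θ ^ n := fun n => by positivity
  have hsum : Summable fun n => 2 ^ d * 2 ^ m * B * R ^ (d - m) * θ ^ n :=
    (summable_geometric_of_lt_one hθ0 hθ1).mul_left _
  have htsum : ∑' n, 2 ^ d * 2 ^ m * B * R ^ (d - m) * θ ^ n =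
      2 ^ d * 2 ^ m * (1 - θ)⁻¹ * B * R ^ (d - m) := by
    rw [tsum_mul_left, tsum_geometric_of_lt_one hθ0 hθ1]
    ring
  -- the pointwise dyadic bound
  have hpt : ∀ w ∈ parabolicBall c R, ENNReal.ofReal (parabolicNorm (c - w) ^ (-m)) ≤
      ∑' n, ENNReal.ofReal (a n) * (parabolicBall c (2 * r n)).indicator 1 w := by
    intro w hw
    rw [mem_parabolicBall] at hw
    set ρ := parabolicNorm (c - w) with hρ
    rcases (parabolicNorm_nonneg (c - w)).eq_or_lt with h0 | hpos
    · rw [← hρ] at h0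
      rw [← h0, Real.zero_rpow (by linarith : -m ≠ 0), ENNReal.ofReal_zero]
      exact zero_le
    · rw [← hρ] at hpos
      have hx : 1 ≤ R / ρ := by rw [le_div_iff₀ hpos]; linarith
      obtain ⟨n, hn1, hn2⟩ := exists_nat_pow_near hx one_lt_two
      have hρle : ρ ≤ r n := by
        rw [hr]
        simp only
        rw [le_div_iff₀ (by positivity)]
        rw [le_div_iff₀ hpos] at hn1
        linarith
      have hρgt : r n / 2 < ρ := by
        rw [hr]
        simp only
        rw [div_div, ← pow_succ, div_lt_iff₀ (by positivity)]
        rw [div_lt_iff₀ hpos] at hn2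
        linarith
      have hmem : w ∈ parabolicBall c (2 * r n) := by
        rw [mem_parabolicBall, ← hρ]
        linarith [hr0 n]
      refine le_trans ?_ (ENNReal.le_tsum n)
      rw [indicator_of_mem hmem, Pi.one_apply, mul_one]
      exact ENNReal.ofReal_le_ofReal
        (Real.rpow_le_rpow_of_nonpos (by linarith [hr0 n]) hρgt.le (by linarith))
  -- integrate
  have hmeas : ∀ n, MeasurableSet (parabolicBall c (2 * r n)) := fun n =>
    measurableSet_parabolicBall _ _
  calc ∫⁻ w in parabolicBall c R, ENNReal.ofReal (parabolicNorm (c - w) ^ (-m)) * ‖F w‖ₑ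
      ≤ ∫⁻ w in parabolicBall c R,
          (∑' n, ENNReal.ofReal (a n) * (parabolicBall c (2 * r n)).indicator 1 w) * ‖F w‖ₑ :=
        setLIntegral_mono' (measurableSet_parabolicBall c R) fun w hw =>
          mul_le_mul' (hpt w hw) le_rfl
    _ ≤ ∫⁻ w, (∑' n, ENNReal.ofReal (a n) * (parabolicBall c (2 * r n)).indicator 1 w) * ‖F w‖ₑ :=
        setLIntegral_le_lintegral _ _
    _ = ∫⁻ w, ∑' n, ENNReal.ofReal (a n) *
          (parabolicBall c (2 * r n)).indicator (fun w => ‖F w‖ₑ) w := by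
        congr 1
        funext w
        rw [← ENNReal.tsum_mul_right]
        congr 1
        funext n
        rw [mul_assoc]
        congr 1
        by_cases hw : w ∈ parabolicBall c (2 * r n)
        · simp [indicator_of_mem hw]
        · simp [indicator_of_notMem hw]
    _ = ∑' n, ∫⁻ w, ENNReal.ofReal (a n) *
          (parabolicBall c (2 * r n)).indicator (fun w => ‖F w‖ₑ) w := by
        refine lintegral_tsum fun n => ?_
        exact ((hF.indicator (hmeas n)).const_mul _)
    _ = ∑' n, ENNReal.ofReal (a n) * ∫⁻ w in parabolicBall c (2 * r n), ‖F w‖ₑ := by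
        congr 1
        funext n
        rw [lintegral_const_mul'' _ (hF.indicator (hmeas n)), lintegral_indicator (hmeas n)]
    _ ≤ ∑' n, ENNReal.ofReal (a n) * ENNReal.ofReal (B * (2 * r n) ^ d) :=
        ENNReal.tsum_le_tsum fun n => mul_le_mul' le_rfl
          (lintegral_parabolicBall_le_of_morrey hMor c (by linarith [hr0 n]))
    _ = ∑' n, ENNReal.ofReal (2 ^ d * 2 ^ m * B * R ^ (d - m) * θ ^ n) := by
        congr 1
        funext n
        rw [← ENNReal.ofReal_mul (ha0 n), hterm n]
    _ = ENNReal.ofReal (∑' n, 2 ^ d * 2 ^ m * B * R ^ (d - m) * θ ^ n) :=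
        (ENNReal.ofReal_tsum_of_nonneg hterm0 hsum).symm
    _ = ENNReal.ofReal (2 ^ d * 2 ^ m * (1 - ((2 : ℝ) ^ (d - m))⁻¹)⁻¹ * B * R ^ (d - m)) := by
        rw [htsum]

/-- **The far-field dyadic estimate**: for `0 < m`, `d < m + 1` and data with
`∫∫_{Q_r(c)} |F| ≤ B r^d`,
`∫_{ρ₂(c-w) ≥ R} ρ₂(c - w)^{-(m+1)} |F(w)| dw ≤ 2^d (1 - 2^{d-m-1})⁻¹ B R^{d-m-1}` (shells
`2^n R ≤ ρ₂ < 2^{n+1} R`). [folklore] -/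
theorem lintegral_compl_parabolicBall_rpow_neg_mul_le {F : ℝ × ℝ³ → E'} {B d m R : ℝ}
    (hB : 0 ≤ B) (hm : 0 < m) (hdm : d < m + 1) (hF : AEMeasurable (fun w => ‖F w‖ₑ) volume)
    (hMor : ∀ (c : ℝ × ℝ³) (r : ℝ), 0 < r →
      ∫⁻ w in FluidPDE.parabolicCylinderCentered r c, ‖F w‖ₑ ≤ ENNReal.ofReal (B * r ^ d))
    (c : ℝ × ℝ³) (hR : 0 < R) :
    ∫⁻ w in (parabolicBall c R)ᶜ, ENNReal.ofReal (parabolicNorm (c - w) ^ (-(m + 1))) * ‖F w‖ₑ ≤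
      ENNReal.ofReal (2 ^ d * (1 - (2 : ℝ) ^ (d - m - 1))⁻¹ * B * R ^ (d - m - 1)) := by
  -- the dyadic radii and the geometric ratio
  set s : ℕ → ℝ := fun n => R * 2 ^ n with hs
  have hs0 : ∀ n, 0 < s n := fun n => by positivity
  set θ : ℝ := (2 : ℝ) ^ (d - m - 1) with hθ
  have hθ0 : 0 ≤ θ := by positivity
  have hθ1 : θ < 1 := Real.rpow_lt_one_of_one_lt_of_neg one_lt_two (by linarith)
  set a : ℕ → ℝ := fun n => s n ^ (-(m + 1)) with ha
  have ha0 : ∀ n, 0 ≤ a n := fun n => Real.rpow_nonneg (hs0 n).le _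
  have hterm : ∀ n, a n * (B * (2 * s n) ^ d) = 2 ^ d * B * R ^ (d - m - 1) * θ ^ n := by
    intro n
    have hsn := hs0 n
    have h2 : (2 * s n) ^ d = 2 ^ d * s n ^ d := Real.mul_rpow (by norm_num) hsn.le
    have h3 : s n ^ (-(m + 1)) * s n ^ d = s n ^ (d - m - 1) := by
      rw [← Real.rpow_add hsn]
      congr 1
      ring
    have h4 : s n ^ (d - m - 1) = R ^ (d - m - 1) * θ ^ n := by
      rw [hs, hθ]
      simp only
      rw [Real.mul_rpow hR.le (by positivity), ← Real.rpow_natCast (2 : ℝ) n,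
        ← Real.rpow_mul (by norm_num : (0 : ℝ) ≤ 2), mul_comm (n : ℝ) (d - m - 1),
        Real.rpow_mul (by norm_num : (0 : ℝ) ≤ 2), Real.rpow_natCast]
    calc a n * (B * (2 * s n) ^ d) = 2 ^ d * B * (s n ^ (-(m + 1)) * s n ^ d) := by
          rw [ha, h2]; ring
      _ = 2 ^ d * B * R ^ (d - m - 1) * θ ^ n := by rw [h3, h4]; ring
  have hterm0 : ∀ n, 0 ≤ 2 ^ d * B * R ^ (d - m - 1) * θ ^ n := fun n => by positivity
  have hsum : Summable fun n => 2 ^ d * B * R ^ (d - m - 1) * θ ^ n :=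
    (summable_geometric_of_lt_one hθ0 hθ1).mul_left _
  have htsum : ∑' n, 2 ^ d * B * R ^ (d - m - 1) * θ ^ n =
      2 ^ d * (1 - θ)⁻¹ * B * R ^ (d - m - 1) := by
    rw [tsum_mul_left, tsum_geometric_of_lt_one hθ0 hθ1]
    ring
  -- the pointwise dyadic bound
  have hpt : ∀ w ∈ (parabolicBall c R)ᶜ, ENNReal.ofReal (parabolicNorm (c - w) ^ (-(m + 1))) ≤
      ∑' n, ENNReal.ofReal (a n) * (parabolicBall c (2 * s n)).indicator 1 w := by
    intro w hw
    rw [mem_compl_iff, mem_parabolicBall, not_lt] at hw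
    set ρ := parabolicNorm (c - w) with hρ
    have hpos : 0 < ρ := hR.trans_le hw
    have hx : 1 ≤ ρ / R := by rw [le_div_iff₀ hR]; linarith
    obtain ⟨n, hn1, hn2⟩ := exists_nat_pow_near hx one_lt_two
    have hρge : s n ≤ ρ := by
      rw [hs]
      simp only
      rw [le_div_iff₀ hR] at hn1
      linarith
    have hρlt : ρ < 2 * s n := by
      rw [hs]
      simp only
      rw [div_lt_iff₀ hR, pow_succ] at hn2
      linarith
    have hmem : w ∈ parabolicBall c (2 * s n) := by
      rw [mem_parabolicBall, ← hρ]
      exact hρlt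
    refine le_trans ?_ (ENNReal.le_tsum n)
    rw [indicator_of_mem hmem, Pi.one_apply, mul_one]
    exact ENNReal.ofReal_le_ofReal (Real.rpow_le_rpow_of_nonpos (hs0 n) hρge (by linarith))
  have hmeas : ∀ n, MeasurableSet (parabolicBall c (2 * s n)) := fun n =>
    measurableSet_parabolicBall _ _
  calc ∫⁻ w in (parabolicBall c R)ᶜ, ENNReal.ofReal (parabolicNorm (c - w) ^ (-(m + 1))) * ‖F w‖ₑ
      ≤ ∫⁻ w in (parabolicBall c R)ᶜ,
          (∑' n, ENNReal.ofReal (a n) * (parabolicBall c (2 * s n)).indicator 1 w) * ‖F w‖ₑ :=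
        setLIntegral_mono' (measurableSet_parabolicBall c R).compl fun w hw =>
          mul_le_mul' (hpt w hw) le_rfl
    _ ≤ ∫⁻ w, (∑' n, ENNReal.ofReal (a n) * (parabolicBall c (2 * s n)).indicator 1 w) * ‖F w‖ₑ :=
        setLIntegral_le_lintegral _ _
    _ = ∫⁻ w, ∑' n, ENNReal.ofReal (a n) *
          (parabolicBall c (2 * s n)).indicator (fun w => ‖F w‖ₑ) w := by
        congr 1
        funext w
        rw [← ENNReal.tsum_mul_right]
        congr 1
        funext n
        rw [mul_assoc]
        congr 1
        by_cases hw : w ∈ parabolicBall c (2 * s n)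
        · simp [indicator_of_mem hw]
        · simp [indicator_of_notMem hw]
    _ = ∑' n, ∫⁻ w, ENNReal.ofReal (a n) *
          (parabolicBall c (2 * s n)).indicator (fun w => ‖F w‖ₑ) w := by
        refine lintegral_tsum fun n => ?_
        exact ((hF.indicator (hmeas n)).const_mul _)
    _ = ∑' n, ENNReal.ofReal (a n) * ∫⁻ w in parabolicBall c (2 * s n), ‖F w‖ₑ := by
        congr 1
        funext n
        rw [lintegral_const_mul'' _ (hF.indicator (hmeas n)), lintegral_indicator (hmeas n)]
    _ ≤ ∑' n, ENNReal.ofReal (a n) * ENNReal.ofReal (B * (2 * s n) ^ d) :=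
        ENNReal.tsum_le_tsum fun n => mul_le_mul' le_rfl
          (lintegral_parabolicBall_le_of_morrey hMor c (by linarith [hs0 n]))
    _ = ∑' n, ENNReal.ofReal (2 ^ d * B * R ^ (d - m - 1) * θ ^ n) := by
        congr 1
        funext n
        rw [← ENNReal.ofReal_mul (ha0 n), hterm n]
    _ = ENNReal.ofReal (∑' n, 2 ^ d * B * R ^ (d - m - 1) * θ ^ n) :=
        (ENNReal.ofReal_tsum_of_nonneg hterm0 hsum).symm
    _ = ENNReal.ofReal (2 ^ d * (1 - (2 : ℝ) ^ (d - m - 1))⁻¹ * B * R ^ (d - m - 1)) := by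
        rw [htsum]

end Dyadic

/-! ### The Hölder estimate -/

section Holder

/-- The constant of `parabolicHolderOnWith_integral_of_kernel_bounds`:
`A B (2^d 2^m (1 - 2^{m-d})⁻¹ (2^α + 3^α) + 2^d (1 - 2^{d-m-1})⁻¹ 2^{α-1})`, `α = d - m`. [folklore] -/
def kernelHolderConst (A B m d : ℝ) : ℝ :=
  A * B * (2 ^ d * 2 ^ m * (1 - ((2 : ℝ) ^ (d - m))⁻¹)⁻¹ * ((2 : ℝ) ^ (d - m) + (3 : ℝ) ^ (d - m)) +
    2 ^ d * (1 - (2 : ℝ) ^ (d - m - 1))⁻¹ * (2 : ℝ) ^ (d - m - 1))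

/-- A kernel with `|K(z)| ρ₂(z)^m ≤ A` and `K(0) = 0` is bounded by `A ρ₂(z)^{-m}` everywhere
(with the convention `0^{-m} = 0` at the origin). [folklore] -/
theorem enorm_le_of_mul_rpow_le {K : ℝ × ℝ³ → ℂ} {A m : ℝ} (hK0 : K 0 = 0)
    (hK1 : ∀ z, ‖K z‖ * parabolicNorm z ^ m ≤ A) (z : ℝ × ℝ³) :
    ‖K z‖ₑ ≤ ENNReal.ofReal A * ENNReal.ofReal (parabolicNorm z ^ (-m)) := by
  by_cases hz : z = 0
  · subst hz
    simp [hK0]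
  · have hρ : 0 < parabolicNorm z := parabolicNorm_pos hz
    have hA : 0 ≤ A :=
      le_trans (mul_nonneg (norm_nonneg _) (Real.rpow_nonneg (parabolicNorm_nonneg z) m)) (hK1 z)
    have h : ‖K z‖ ≤ A * parabolicNorm z ^ (-m) := by
      rw [Real.rpow_neg hρ.le, ← div_eq_mul_inv, le_div_iff₀ (Real.rpow_pos_of_pos hρ _)]
      exact hK1 z
    rw [← ofReal_norm, ← ENNReal.ofReal_mul hA]
    exact ENNReal.ofReal_le_ofReal h

/-- **Hölder continuity of parabolic singular potentials of Morrey data** (the real-variable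
content of Lemarié-Rieusset 2016, Prop. 13.4, proof p. 465). Let `K : ℝ × ℝ³ → ℂ` be measurable
with `K(0) = 0`, `|K(z)| ρ₂(z)^m ≤ A` and `|K(z) - K(z - z')| ρ₂(z)^{m+1} ≤ A ρ₂(z')` whenever
`2ρ₂(z') ≤ ρ₂(z)`; let `F` be measurable with `∫∫_{Q_r(c)} |F| ≤ B r^d` for all `c`, `r > 0`,
where `0 < m < d < m + 1`; and assume `w ↦ K(z - w) F(w)` is integrable for every `z`. Then
`h(z) = ∫ K(z - w) F(w) dw` satisfies `|h(z₁) - h(z₂)| ≤ C ρ₂(z₁ - z₂)^{d-m}` on `ℝ × ℝ³` with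
`C = kernelHolderConst A B m d`: split the integral at `ρ₂(z₁ - w) = 2δ`, `δ = ρ₂(z₁ - z₂)`; near
the points use the size bound and `lintegral_parabolicBall_rpow_neg_mul_le` (radii `2δ` about
`z₁`, `3δ` about `z₂`), far away the regularity bound and
`lintegral_compl_parabolicBall_rpow_neg_mul_le`. [cite: LemarieRieusset2016, Prop. 13.4 proof p. 465] -/
theorem parabolicHolderOnWith_integral_of_kernel_bounds {K F : ℝ × ℝ³ → ℂ} {A B m d : ℝ}
    (hK : Measurable K) (hF : Measurable F) (hB : 0 ≤ B) (hm : 0 < m) (hmd : m < d)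
    (hdm : d < m + 1) (hK0 : K 0 = 0) (hK1 : ∀ z, ‖K z‖ * parabolicNorm z ^ m ≤ A)
    (hK2 : ∀ z z' : ℝ × ℝ³, 2 * parabolicNorm z' ≤ parabolicNorm z →
      ‖K z - K (z - z')‖ * parabolicNorm z ^ (m + 1) ≤ A * parabolicNorm z')
    (hMor : ∀ (c : ℝ × ℝ³) (r : ℝ), 0 < r →
      ∫⁻ w in FluidPDE.parabolicCylinderCentered r c, ‖F w‖ₑ ≤ ENNReal.ofReal (B * r ^ d))
    (hint : ∀ z, Integrable (fun w => K (z - w) * F w)) :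
    ParabolicHolderOnWith (kernelHolderConst A B m d) (d - m) (fun z => ∫ w, K (z - w) * F w)
      univ := by
  have hA : 0 ≤ A :=
    le_trans (mul_nonneg (norm_nonneg _) (Real.rpow_nonneg (parabolicNorm_nonneg _) m)) (hK1 0)
  -- the constants
  set C₁ : ℝ := 2 ^ d * 2 ^ m * (1 - ((2 : ℝ) ^ (d - m))⁻¹)⁻¹ with hC₁
  set C₂ : ℝ := 2 ^ d * (1 - (2 : ℝ) ^ (d - m - 1))⁻¹ with hC₂
  have h2dm : 1 < (2 : ℝ) ^ (d - m) := Real.one_lt_rpow one_lt_two (by linarith)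
  have hC₁0 : 0 ≤ C₁ := by
    have : 0 < 1 - ((2 : ℝ) ^ (d - m))⁻¹ := sub_pos.2 (inv_lt_one_of_one_lt₀ h2dm)
    positivity
  have hC₂0 : 0 ≤ C₂ := by
    have : 0 < 1 - (2 : ℝ) ^ (d - m - 1) :=
      sub_pos.2 (Real.rpow_lt_one_of_one_lt_of_neg one_lt_two (by linarith))
    positivity
  have hC0 : 0 ≤ kernelHolderConst A B m d := by
    unfold kernelHolderConst
    rw [← hC₁, ← hC₂]
    positivity
  have hFm : AEMeasurable (fun w => ‖F w‖ₑ) volume := hF.enorm.aemeasurable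
  intro z₁ _ z₂ _
  rw [parabolicDist_eq_parabolicNorm]
  set δ : ℝ := parabolicNorm (z₁ - z₂) with hδ
  rcases (parabolicNorm_nonneg (z₁ - z₂)).eq_or_lt with h0 | hδ0
  · -- `z₁ = z₂`
    have h12 : z₁ = z₂ := sub_eq_zero.1 ((parabolicNorm_eq_zero_iff _).1 h0.symm)
    subst h12
    simp only [sub_self, norm_zero]
    positivity
  rw [← hδ] at hδ0
  -- the difference of the potentials as one integral
  have hsub : (∫ w, K (z₁ - w) * F w) - ∫ w, K (z₂ - w) * F w =
      ∫ w, (K (z₁ - w) - K (z₂ - w)) * F w := by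
    rw [← integral_sub (hint z₁) (hint z₂)]
    congr 1
    funext w
    ring
  rw [hsub]
  refine (norm_integral_le_lintegral_norm _).trans
    (ENNReal.toReal_le_of_le_ofReal (by positivity) ?_)
  -- the `lintegral` bound
  set N : Set (ℝ × ℝ³) := parabolicBall z₁ (2 * δ) with hN
  have hNm : MeasurableSet N := measurableSet_parabolicBall _ _
  have hG : ∀ w, ENNReal.ofReal ‖(K (z₁ - w) - K (z₂ - w)) * F w‖ =
      ‖K (z₁ - w) - K (z₂ - w)‖ₑ * ‖F w‖ₑ := fun w => by
    rw [ofReal_norm, enorm_mul]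
  simp_rw [hG]
  rw [← lintegral_add_compl _ hNm]
  -- near part
  have hnear : ∫⁻ w in N, ‖K (z₁ - w) - K (z₂ - w)‖ₑ * ‖F w‖ₑ ≤
      ENNReal.ofReal (A * (C₁ * B * (2 * δ) ^ (d - m))) +
        ENNReal.ofReal (A * (C₁ * B * (3 * δ) ^ (d - m))) := by
    have hK₁ : ∀ w, ‖K (z₁ - w)‖ₑ * ‖F w‖ₑ ≤
        ENNReal.ofReal A * (ENNReal.ofReal (parabolicNorm (z₁ - w) ^ (-m)) * ‖F w‖ₑ) :=
      fun w => by
        rw [← mul_assoc]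
        exact mul_le_mul' (enorm_le_of_mul_rpow_le hK0 hK1 _) le_rfl
    have hK₂ : ∀ w, ‖K (z₂ - w)‖ₑ * ‖F w‖ₑ ≤
        ENNReal.ofReal A * (ENNReal.ofReal (parabolicNorm (z₂ - w) ^ (-m)) * ‖F w‖ₑ) :=
      fun w => by
        rw [← mul_assoc]
        exact mul_le_mul' (enorm_le_of_mul_rpow_le hK0 hK1 _) le_rfl
    have hNsub : N ⊆ parabolicBall z₂ (3 * δ) := by
      intro w hw
      rw [hN, mem_parabolicBall] at hw
      rw [mem_parabolicBall]
      calc parabolicNorm (z₂ - w) ≤ parabolicNorm (z₂ - z₁) + parabolicNorm (z₁ - w) :=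
            parabolicNorm_sub_le _ _ _
        _ < δ + 2 * δ := by rw [parabolicNorm_sub_comm, ← hδ]; linarith
        _ = 3 * δ := by ring
    have hmeas₁ : Measurable fun w => ‖K (z₁ - w)‖ₑ * ‖F w‖ₑ :=
      (hK.comp (measurable_const.sub measurable_id)).enorm.mul hF.enorm
    calc ∫⁻ w in N, ‖K (z₁ - w) - K (z₂ - w)‖ₑ * ‖F w‖ₑ
        ≤ ∫⁻ w in N, (‖K (z₁ - w)‖ₑ * ‖F w‖ₑ + ‖K (z₂ - w)‖ₑ * ‖F w‖ₑ) := by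
          refine lintegral_mono fun w => ?_
          rw [← add_mul]
          exact mul_le_mul' enorm_sub_le le_rfl
      _ = (∫⁻ w in N, ‖K (z₁ - w)‖ₑ * ‖F w‖ₑ) + ∫⁻ w in N, ‖K (z₂ - w)‖ₑ * ‖F w‖ₑ :=
          lintegral_add_left hmeas₁ _
      _ ≤ (∫⁻ w in N, ENNReal.ofReal A *
              (ENNReal.ofReal (parabolicNorm (z₁ - w) ^ (-m)) * ‖F w‖ₑ)) +
            ∫⁻ w in parabolicBall z₂ (3 * δ), ENNReal.ofReal A *
              (ENNReal.ofReal (parabolicNorm (z₂ - w) ^ (-m)) * ‖F w‖ₑ) :=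
          add_le_add (lintegral_mono fun w => hK₁ w)
            ((lintegral_mono_set hNsub).trans (lintegral_mono fun w => hK₂ w))
      _ = ENNReal.ofReal A *
              (∫⁻ w in N, ENNReal.ofReal (parabolicNorm (z₁ - w) ^ (-m)) * ‖F w‖ₑ) +
            ENNReal.ofReal A * ∫⁻ w in parabolicBall z₂ (3 * δ),
              ENNReal.ofReal (parabolicNorm (z₂ - w) ^ (-m)) * ‖F w‖ₑ := by
          rw [lintegral_const_mul' _ _ ENNReal.ofReal_ne_top,
            lintegral_const_mul' _ _ ENNReal.ofReal_ne_top]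
      _ ≤ ENNReal.ofReal A * ENNReal.ofReal (C₁ * B * (2 * δ) ^ (d - m)) +
            ENNReal.ofReal A * ENNReal.ofReal (C₁ * B * (3 * δ) ^ (d - m)) := by
          gcongr
          · exact lintegral_parabolicBall_rpow_neg_mul_le hB hm hmd hFm hMor z₁ (by linarith)
          · exact lintegral_parabolicBall_rpow_neg_mul_le hB hm hmd hFm hMor z₂ (by linarith)
      _ = ENNReal.ofReal (A * (C₁ * B * (2 * δ) ^ (d - m))) +
            ENNReal.ofReal (A * (C₁ * B * (3 * δ) ^ (d - m))) := by
          rw [← ENNReal.ofReal_mul hA, ← ENNReal.ofReal_mul hA]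
  -- far part
  have hfar : ∫⁻ w in Nᶜ, ‖K (z₁ - w) - K (z₂ - w)‖ₑ * ‖F w‖ₑ ≤
      ENNReal.ofReal (A * δ * (C₂ * B * (2 * δ) ^ (d - m - 1))) := by
    have hpt : ∀ w ∈ Nᶜ, ‖K (z₁ - w) - K (z₂ - w)‖ₑ * ‖F w‖ₑ ≤
        ENNReal.ofReal (A * δ) *
          (ENNReal.ofReal (parabolicNorm (z₁ - w) ^ (-(m + 1))) * ‖F w‖ₑ) := by
      intro w hw
      rw [hN, mem_compl_iff, mem_parabolicBall, not_lt] at hw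
      have hρ : 0 < parabolicNorm (z₁ - w) := by linarith
      have h1 := hK2 (z₁ - w) (z₁ - z₂) (by rw [← hδ]; exact hw)
      rw [show z₁ - w - (z₁ - z₂) = z₂ - w by abel, ← hδ] at h1
      have h2 : ‖K (z₁ - w) - K (z₂ - w)‖ ≤ A * δ * parabolicNorm (z₁ - w) ^ (-(m + 1)) := by
        rw [Real.rpow_neg hρ.le, ← div_eq_mul_inv, le_div_iff₀ (Real.rpow_pos_of_pos hρ _)]
        exact h1
      rw [← mul_assoc]
      refine mul_le_mul' ?_ le_rfl
      rw [← ofReal_norm, ← ENNReal.ofReal_mul (by positivity)]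
      exact ENNReal.ofReal_le_ofReal h2
    calc ∫⁻ w in Nᶜ, ‖K (z₁ - w) - K (z₂ - w)‖ₑ * ‖F w‖ₑ
        ≤ ∫⁻ w in Nᶜ, ENNReal.ofReal (A * δ) *
            (ENNReal.ofReal (parabolicNorm (z₁ - w) ^ (-(m + 1))) * ‖F w‖ₑ) :=
          setLIntegral_mono' hNm.compl hpt
      _ = ENNReal.ofReal (A * δ) * ∫⁻ w in Nᶜ,
            ENNReal.ofReal (parabolicNorm (z₁ - w) ^ (-(m + 1))) * ‖F w‖ₑ :=
          lintegral_const_mul' _ _ ENNReal.ofReal_ne_top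
      _ ≤ ENNReal.ofReal (A * δ) * ENNReal.ofReal (C₂ * B * (2 * δ) ^ (d - m - 1)) := by
          gcongr
          exact lintegral_compl_parabolicBall_rpow_neg_mul_le hB hm hdm hFm hMor z₁ (by linarith)
      _ = ENNReal.ofReal (A * δ * (C₂ * B * (2 * δ) ^ (d - m - 1))) := by
          rw [← ENNReal.ofReal_mul (by positivity)]
  -- conclusion
  refine (add_le_add hnear hfar).trans (le_of_eq ?_)
  rw [← ENNReal.ofReal_add (by positivity) (by positivity),
    ← ENNReal.ofReal_add (by positivity) (by positivity)]
  congr 1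
  have h2δ : (2 * δ) ^ (d - m) = (2 : ℝ) ^ (d - m) * δ ^ (d - m) :=
    Real.mul_rpow (by norm_num) hδ0.le
  have h3δ : (3 * δ) ^ (d - m) = (3 : ℝ) ^ (d - m) * δ ^ (d - m) :=
    Real.mul_rpow (by norm_num) hδ0.le
  have h2δ' : δ * (2 * δ) ^ (d - m - 1) = (2 : ℝ) ^ (d - m - 1) * δ ^ (d - m) := by
    rw [Real.mul_rpow (by norm_num) hδ0.le]
    have : δ * δ ^ (d - m - 1) = δ ^ (d - m) := by
      conv_lhs => rw [show δ = δ ^ (1 : ℝ) by rw [Real.rpow_one]]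
      rw [← Real.rpow_mul hδ0.le, one_mul, ← Real.rpow_add hδ0]
      congr 1
      ring
    calc δ * ((2 : ℝ) ^ (d - m - 1) * δ ^ (d - m - 1))
        = (2 : ℝ) ^ (d - m - 1) * (δ * δ ^ (d - m - 1)) := by ring
      _ = (2 : ℝ) ^ (d - m - 1) * δ ^ (d - m) := by rw [this]
  have hre : A * δ * (C₂ * B * (2 * δ) ^ (d - m - 1)) =
      A * C₂ * B * (δ * (2 * δ) ^ (d - m - 1)) := by ring
  rw [h2δ, h3δ, hre, h2δ']
  unfold kernelHolderConst
  rw [← hC₁, ← hC₂]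
  ring

end Holder

/-! ### Bridges to the accepted Morrey condition and heat potentials -/

/-- **From `ℳ₂^{p,q}` to the `L¹`-Morrey bound**: if `F ∈ ℳ₂^{p,q}` on `ℝ × ℝ³` with
`1 ≤ p` (`IsParabolicMorreyOn univ`), then `∫∫_{Q_r(c)} |F| ≤ B r^{5(1 - 1/q)}` for some `B ≥ 0`
and all `c`, `r > 0` (Hölder on cylinders, the accepted `IsParabolicMorreyOn.of_integrability_le`). [folklore] -/
theorem exists_morrey_one_bound {E' : Type*} [NormedAddCommGroup E'] {F : ℝ × ℝ³ → E'}
    {p q : ℝ} (hp : 1 ≤ p) (hF : AEMeasurable (fun w => ‖F w‖ₑ) volume)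
    (hM : IsParabolicMorreyOn univ (fun w => ‖F w‖ₑ) p q) :
    ∃ B : ℝ, 0 ≤ B ∧ ∀ (c : ℝ × ℝ³) (r : ℝ), 0 < r →
      ∫⁻ w in FluidPDE.parabolicCylinderCentered r c, ‖F w‖ₑ ≤
        ENNReal.ofReal (B * r ^ (5 * (1 - 1 / q))) := by
  obtain ⟨M, hM1⟩ := hM.of_integrability_le hF one_pos hp
  refine ⟨M, M.2, fun c r hr => ?_⟩
  have h := hM1 c r hr
  simp only [ENNReal.rpow_one, inter_univ] at h
  rw [ENNReal.ofReal_mul M.coe_nonneg, ENNReal.ofReal_coe_nnreal]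
  exact h

/-- The accepted heat potential of complex data is an integral of the form treated above:
`heatPotential ν F (z) = ∫ W₊(z - w) F(w) dw` with the kernel cast to `ℂ`. [folklore] -/
theorem heatPotential_eq_integral_mul (ν : ℝ) (F : ℝ × ℝ³ → ℂ) (z : ℝ × ℝ³) :
    heatPotential ν F z = ∫ w, ((heatKernelFwd ν (z - w) : ℝ) : ℂ) * F w := by
  simp only [heatPotential, Complex.real_smul]

end Literature.Analysis.FluidPDE
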